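import Mathlib.FieldTheory.Finite.Basic
import Mathlib.Data.Nat.Factors
import Mathlib.Data.Nat.Prime.Int
import Mathlib.RingTheory.Coprime.Lemmas
import Mathlib.Tactic.LinearCombination
import Mathlib.Tactic.FieldSimp
import Mathlib.Tactic.NormNum.Prime
import HarnessLib

set_option linter.dupNamespace false

/-!
# Road ε, part 1: the cyclotomic sieve for the split-`5` family (arithmetic of `Q₈`)

Pure arithmetic input for E-es-228 `ShimuraFiveSquarefreeOnlyAtEleven` (node `ShimuraFiveResidual`), cell
`bsd-f2-manin`, MEMO-es §68.  By the landed E-es-239 (`ShimuraFive.splitFiveTorsionModuli_holds`) an optimal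
curve with a rational `5`-point and split `5`-torsion is `veluFive (s⁵)`, `s = U/V`; its integral model
`kubertTateFive' (U⁵) (V⁵)` has discriminant `U⁵ V⁵ g⁵` with
`g = U¹⁰ − 11 U⁵ V⁵ − V¹⁰ = (U² − U V − V²) · Q₈(U,V)`,
`Q₈ = U⁸ + U⁷V + 2U⁶V² + 3U⁵V³ + 5U⁴V⁴ − 3U³V⁵ + 2U²V⁶ − UV⁷ + V⁸` (`splitFiveOctic`, §1).
This file proves the two elementary lemmas that replace the Diophantine step of Byeon–Kim
(Acta Arith. 165 (2014), proof of Thm 1.1, eq. (9)–(10)):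

* §2 **Lemma A1 (cyclotomic sieve).** For a prime `q ∉ {2, 5}` with `5 ∤ q − 1`, `Q₈(x, 1)` has no root in
  `ZMod q` (`splitFiveOctic_zmod_ne_zero`); hence for coprime `U, V` no such `q` divides `Q₈(U,V)`
  (`not_prime_dvd_splitFiveOctic`): every odd prime factor `≠ 5` of `Q₈(U,V)` is `≡ 1 (mod 5)`.
  Proof in `𝔽_q`: a root `x` gives `y = x⁵` with `(2y − 11)² = 125`, so `r = (2y−11)/5` has `r² = 5`,
  `φ = (1+r)/2` has `φ² = φ + 1`, `φ⁵ = 5φ + 3 = y = x⁵`; as `gcd(5, q−1) = 1`, `x = φ`, and then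
  `Q₈(x,1) = 25(3x+2) ≠ 0`.
* §3 **Lemma A2 (endgame).** If `U, V ≠ 0` are coprime, every prime dividing `UV` is `11`, and (when `11 ∣ UV`)
  every prime dividing `Q₈(U,V)` is `5` or `11`, then `UV = ±1` (`mul_eq_one_or_eq_neg_one_of_splitFive_primes`).

In the assembly of E-es-228 (MEMO-es §68.1) the primes of `UV` are split multiplicative (hence `= 11` by the
Atkin–Lehner sign law) and the primes `≠ 5` of `Q₈(U,V)` are multiplicative, hence divide the squarefree level and
are `11` or `≡ 4 (mod 5)` by the Ling–Oesterlé profile (E-es-229) — Lemma A1 excludes the latter, Lemma A2 then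
forces `s⁵ = ±1`, i.e. `N = 11`.  BSD is not proved here; C2/C3 remain OPEN ⟸ CDT.
-/

namespace Summit.BirchSwinnertonDyer.BirchSwinnertonDyer.Theorems.ManinLocalTwoThree.ShimuraFive

/-! ## §1 The octic factor `Q₈` of the norm form `U¹⁰ − 11U⁵V⁵ − V¹⁰` -/

section Octic

variable {R : Type*} [CommRing R]

/-- `Q₈(U,V) = U⁸ + U⁷V + 2U⁶V² + 3U⁵V³ + 5U⁴V⁴ − 3U³V⁵ + 2U²V⁶ − UV⁷ + V⁸`, the cofactor of `U² − UV − V²` in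
`U¹⁰ − 11U⁵V⁵ − V¹⁰` (the norm of `U − ζ₅ φ V` times that of `U − ζ₅² φ V`). [this file] -/
def splitFiveOctic (U V : R) : R :=
  U ^ 8 + U ^ 7 * V + 2 * U ^ 6 * V ^ 2 + 3 * U ^ 5 * V ^ 3 + 5 * U ^ 4 * V ^ 4 - 3 * U ^ 3 * V ^ 5
    + 2 * U ^ 2 * V ^ 6 - U * V ^ 7 + V ^ 8

/-- `U¹⁰ − 11U⁵V⁵ − V¹⁰ = (U² − UV − V²) · Q₈(U,V)`. [this file] -/
theorem splitFiveNorm_eq_mul_splitFiveOctic (U V : R) :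
    U ^ 10 - 11 * U ^ 5 * V ^ 5 - V ^ 10 = (U ^ 2 - U * V - V ^ 2) * splitFiveOctic U V := by
  unfold splitFiveOctic; ring

/-- The symmetry `Q₈(V, −U) = Q₈(U, V)`. [this file] -/
theorem splitFiveOctic_swap_neg (U V : R) : splitFiveOctic V (-U) = splitFiveOctic U V := by
  unfold splitFiveOctic; ring

/-- `Q₈(U,V) = V⁸ + U · S₇(U,V)`: `Q₈(U,V) ≡ V⁸ (mod U)`. [this file] -/
theorem splitFiveOctic_eq_pow_add_mul (U V : R) : splitFiveOctic U V = V ^ 8 +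
    U * (U ^ 7 + U ^ 6 * V + 2 * U ^ 5 * V ^ 2 + 3 * U ^ 4 * V ^ 3 + 5 * U ^ 3 * V ^ 4
      - 3 * U ^ 2 * V ^ 5 + 2 * U * V ^ 6 - V ^ 7) := by
  unfold splitFiveOctic; ring

/-- `Q₈(U,V) ≡ 11 (mod U² − 1, V² − 1)`, with explicit cofactors. [this file] -/
theorem splitFiveOctic_eq_eleven_add (U V : R) : splitFiveOctic U V = 11 +
    (U ^ 2 - 1) * (U ^ 6 + U ^ 5 * V + 2 * U ^ 4 * V ^ 2 + U ^ 4 + 3 * U ^ 3 * V ^ 3 + U ^ 3 * V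
      + 5 * U ^ 2 * V ^ 4 + 2 * U ^ 2 * V ^ 2 + U ^ 2 - 3 * U * V ^ 5 + 3 * U * V ^ 3 + U * V
      + 2 * V ^ 6 + 5 * V ^ 4 + 2 * V ^ 2 + 1) +
    (V ^ 2 - 1) * (-(U * V ^ 5) - 4 * U * V ^ 3 - U * V + V ^ 6 + 3 * V ^ 4 + 8 * V ^ 2 + 10) := by
  unfold splitFiveOctic; ring

/-- Casting `Q₈(U,V)` from `ℤ`. [this file] -/
theorem cast_splitFiveOctic (U V : ℤ) : ((splitFiveOctic U V : ℤ) : R) = splitFiveOctic (U : R) (V : R) := by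
  unfold splitFiveOctic; push_cast; ring

end Octic

/-! ## §2 Lemma A1: the cyclotomic sieve -/

/-- **Lemma A1, field form.** For a prime `q ∉ {2, 5}` with `5 ∤ q − 1`, `Q₈(x,1) ≠ 0` for every `x ∈ 𝔽_q`.
[this file; MEMO-es §68.2] -/
theorem splitFiveOctic_zmod_ne_zero {q : ℕ} [hq : Fact q.Prime] (h2 : q ≠ 2) (h5 : q ≠ 5)
    (hq1 : ¬ 5 ∣ q - 1) (x : ZMod q) : splitFiveOctic x 1 ≠ 0 := by
  intro h
  have natCast_ne : ∀ m : ℕ, m.Prime → q ≠ m → ((m : ℤ) : ZMod q) ≠ 0 := by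
    intro m hm hqm h0
    have hdvd : (q : ℤ) ∣ (m : ℤ) := (ZMod.intCast_zmod_eq_zero_iff_dvd (m : ℤ) q).mp h0
    exact hqm ((Nat.prime_dvd_prime_iff_eq hq.out hm).mp (Int.natCast_dvd_natCast.mp hdvd))
  have h2' : (2 : ZMod q) ≠ 0 := by exact_mod_cast natCast_ne 2 Nat.prime_two h2
  have h5' : (5 : ZMod q) ≠ 0 := by exact_mod_cast natCast_ne 5 (by norm_num) h5
  have h25 : (25 : ZMod q) ≠ 0 := by
    rw [show (25 : ZMod q) = 5 * 5 by norm_num]; exact mul_ne_zero h5' h5'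
  have h4 : (4 : ZMod q) ≠ 0 := by
    rw [show (4 : ZMod q) = 2 * 2 by norm_num]; exact mul_ne_zero h2' h2'
  have hQ : x ^ 8 + x ^ 7 + 2 * x ^ 6 + 3 * x ^ 5 + 5 * x ^ 4 - 3 * x ^ 3 + 2 * x ^ 2 - x + 1 = 0 := by
    unfold splitFiveOctic at h; linear_combination h
  -- the norm relation `x¹⁰ − 11 x⁵ − 1 = 0` and `(2x⁵ − 11)² = 125`
  have hg : x ^ 10 - 11 * x ^ 5 - 1 = 0 := by linear_combination (x ^ 2 - x - 1) * hQ
  have h125 : (2 * x ^ 5 - 11) ^ 2 = 125 := by linear_combination 4 * hg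
  -- `r = √5`, `φ` the golden ratio in `𝔽_q`
  obtain ⟨r, hr⟩ : ∃ r : ZMod q, r = (2 * x ^ 5 - 11) / 5 := ⟨_, rfl⟩
  have hr5 : 5 * r = 2 * x ^ 5 - 11 := by rw [hr]; field_simp
  have hr2 : r ^ 2 = 5 := by
    have h' : (5 * r) ^ 2 = 125 := by rw [hr5]; exact h125
    apply mul_left_cancel₀ h25
    linear_combination h'
  obtain ⟨φ, hφ⟩ : ∃ φ : ZMod q, φ = (1 + r) / 2 := ⟨_, rfl⟩
  have hφ2 : 2 * φ = 1 + r := by rw [hφ]; field_simp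
  have hφsq : φ ^ 2 = φ + 1 := by
    apply mul_left_cancel₀ h4
    linear_combination (2 * φ + r - 1) * hφ2 + hr2
  have hφ5 : φ ^ 5 = 5 * φ + 3 := by linear_combination (φ ^ 3 + φ ^ 2 + 2 * φ + 3) * hφsq
  have hx5 : x ^ 5 = φ ^ 5 := by
    rw [hφ5]
    have h' : 2 * (5 * φ + 3) = 2 * x ^ 5 := by linear_combination 5 * hφ2 + hr5
    exact (mul_left_cancel₀ h2' h').symm
  have hφ0 : φ ≠ 0 := by
    intro h0; rw [h0] at hφsq; norm_num at hφsq
  have hx0 : x ≠ 0 := by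
    intro h0; rw [h0] at hg; norm_num at hg
  -- `t = x / φ` has `t⁵ = 1 = t^(q-1)`, so `t = 1` as `gcd (5, q − 1) = 1`
  have ht5 : (x / φ) ^ 5 = 1 := by rw [div_pow, hx5, div_self (pow_ne_zero 5 hφ0)]
  have ht0 : x / φ ≠ 0 := div_ne_zero hx0 hφ0
  have htq : (x / φ) ^ (q - 1) = 1 := ZMod.pow_card_sub_one_eq_one ht0
  have hcop : Nat.Coprime 5 (q - 1) := (Nat.Prime.coprime_iff_not_dvd (by norm_num)).mpr hq1
  have hord : orderOf (x / φ) ∣ Nat.gcd 5 (q - 1) :=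
    Nat.dvd_gcd (orderOf_dvd_of_pow_eq_one ht5) (orderOf_dvd_of_pow_eq_one htq)
  rw [Nat.Coprime.gcd_eq_one hcop, Nat.dvd_one, orderOf_eq_one_iff, div_eq_one_iff_eq hφ0] at hord
  -- so `x = φ`, `x² = x + 1`, and `Q₈(x,1) = 25 (3x + 2)`
  have hxsq : x ^ 2 = x + 1 := by rw [hord]; exact hφsq
  have h75 : 25 * (3 * x + 2) = 0 := by
    linear_combination hQ - (x ^ 6 + 2 * x ^ 5 + 5 * x ^ 4 + 10 * x ^ 3 + 20 * x ^ 2 + 27 * x + 49) * hxsq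
  have h3 : 3 * x + 2 = 0 := by
    rcases mul_eq_zero.mp h75 with h' | h'
    · exact absurd h' h25
    · exact h'
  have h10 : (1 : ZMod q) = 0 := by linear_combination (5 - 3 * x) * h3 + 9 * hxsq
  exact one_ne_zero h10

/-- **Lemma A1, homogeneous form.** For coprime integers `U, V` and a prime `q ∉ {2, 5}` with `5 ∤ q − 1`,
`q ∤ Q₈(U,V)`: every odd prime factor `≠ 5` of `Q₈(U,V)` is `≡ 1 (mod 5)`. [this file; MEMO-es §68.2] -/
theorem not_prime_dvd_splitFiveOctic {U V : ℤ} (hUV : IsCoprime U V) {q : ℕ} (hq : q.Prime)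
    (h2 : q ≠ 2) (h5 : q ≠ 5) (hq1 : ¬ 5 ∣ q - 1) : ¬ (q : ℤ) ∣ splitFiveOctic U V := by
  haveI := Fact.mk hq
  intro hdvd
  have hz : splitFiveOctic (U : ZMod q) (V : ZMod q) = 0 := by
    rw [← cast_splitFiveOctic]; exact (ZMod.intCast_zmod_eq_zero_iff_dvd _ q).mpr hdvd
  by_cases hV : (V : ZMod q) = 0
  · have hU8 : (U : ZMod q) ^ 8 = 0 := by
      have h' := hz; unfold splitFiveOctic at h'; rw [hV] at h'; simpa using h'
    have hU : (U : ZMod q) = 0 := pow_eq_zero_iff (by norm_num) |>.mp hU8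
    have hqU : (q : ℤ) ∣ U := (ZMod.intCast_zmod_eq_zero_iff_dvd U q).mp hU
    have hqV : (q : ℤ) ∣ V := (ZMod.intCast_zmod_eq_zero_iff_dvd V q).mp hV
    have hunit : IsUnit (q : ℤ) := hUV.isUnit_of_dvd' hqU hqV
    rw [Int.isUnit_iff] at hunit
    have h1 := hq.one_lt
    omega
  · have hV8 : (V : ZMod q) ^ 8 ≠ 0 := pow_ne_zero 8 hV
    have hx : splitFiveOctic ((U : ZMod q) / V) 1 = 0 := by
      have h' : splitFiveOctic ((U : ZMod q) / V) 1 = splitFiveOctic (U : ZMod q) V / V ^ 8 := by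
        rw [eq_div_iff hV8]; unfold splitFiveOctic; field_simp
      rw [h', hz, zero_div]
    exact splitFiveOctic_zmod_ne_zero h2 h5 hq1 _ hx

/-! ## §3 Lemma A2: the endgame -/

/-- Endgame, asymmetric core: under the hypotheses of Lemma A2, `11 ∣ U` is impossible. [this file] -/
private theorem false_of_eleven_dvd {U V : ℤ} (hUV : IsCoprime U V) (hU : U ≠ 0)
    (hp : ∀ p : ℕ, p.Prime → (p : ℤ) ∣ U * V → p = 11)
    (hQ : ∀ p : ℕ, p.Prime → (p : ℤ) ∣ splitFiveOctic U V → p = 5 ∨ p = 11)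
    (h11 : (11 : ℤ) ∣ U) : False := by
  -- (1) `V = ±1`: a prime of `V` would be `11`, which also divides `U`
  have hV1 : V.natAbs = 1 := by
    rw [Nat.eq_one_iff_not_exists_prime_dvd]
    intro p hpp hpV
    have hpV' : (p : ℤ) ∣ V := Int.dvd_natAbs.mp (Int.natCast_dvd_natCast.mpr hpV)
    have hp11 : p = 11 := hp p hpp (Dvd.dvd.mul_left hpV' U)
    subst hp11
    have hunit : IsUnit ((11 : ℕ) : ℤ) := hUV.isUnit_of_dvd' (by exact_mod_cast h11) hpV'
    rw [Int.isUnit_iff] at hunit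
    omega
  have hV2 : V ^ 2 = 1 := by
    rcases Int.natAbs_eq V with h | h <;> rw [h, hV1] <;> norm_num
  -- (2) `|U| = 11ᵏ`, so `5 ∣ U² − 1`
  have hU0 : U.natAbs ≠ 0 := Int.natAbs_ne_zero.mpr hU
  obtain ⟨k, hk⟩ : ∃ k : ℕ, U.natAbs = 11 ^ k :=
    ⟨_, Nat.eq_prime_pow_of_unique_prime_dvd hU0 fun {d} hd hdU ↦
      hp d hd (Dvd.dvd.mul_right (Int.dvd_natAbs.mp (Int.natCast_dvd_natCast.mpr hdU)) V)⟩
  have hU2 : U ^ 2 = ((11 : ℤ) ^ 2) ^ k := by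
    have habs : ((U.natAbs : ℕ) : ℤ) ^ 2 = ((11 : ℤ) ^ 2) ^ k := by
      rw [hk, Nat.cast_pow, Nat.cast_ofNat, ← pow_mul, ← pow_mul, mul_comm]
    rcases Int.natAbs_eq U with h | h
    · rw [h]; exact habs
    · rw [h, neg_sq]; exact habs
  have h5U : (5 : ℤ) ∣ U ^ 2 - 1 := by
    have h120 := sub_dvd_pow_sub_pow ((11 : ℤ) ^ 2) 1 k
    rw [one_pow, ← hU2] at h120
    exact dvd_trans ⟨24, by norm_num⟩ h120
  -- (3) `5 ∤ Q₈(U,V)` and `11 ∤ Q₈(U,V)`, so `Q₈(U,V) = ±1`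
  have hV8 : V ^ 8 = 1 := by rw [show V ^ 8 = (V ^ 2) ^ 4 by ring, hV2, one_pow]
  have hQ5 : ¬ (5 : ℤ) ∣ splitFiveOctic U V := by
    intro h
    rw [splitFiveOctic_eq_eleven_add, hV2, sub_self, zero_mul, add_zero] at h
    have h' : (5 : ℤ) ∣ 11 := (dvd_add_left (h5U.mul_right _)).mp h
    omega
  have hQ11 : ¬ (11 : ℤ) ∣ splitFiveOctic U V := by
    intro h
    rw [splitFiveOctic_eq_pow_add_mul, hV8] at h
    have h' : (11 : ℤ) ∣ 1 := (dvd_add_left (h11.mul_right _)).mp h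
    omega
  have hQ1 : (splitFiveOctic U V).natAbs = 1 := by
    rw [Nat.eq_one_iff_not_exists_prime_dvd]
    intro p hpp hpQ
    have hpQ' : (p : ℤ) ∣ splitFiveOctic U V := Int.dvd_natAbs.mp (Int.natCast_dvd_natCast.mpr hpQ)
    rcases hQ p hpp hpQ' with rfl | rfl
    · exact hQ5 (by exact_mod_cast hpQ')
    · exact hQ11 (by exact_mod_cast hpQ')
  -- (4) `Q₈(U,V) = V⁸ + U·S₇ = 1 + U·S₇ ∈ {±1}`: either `S₇ = 0`, `U ∣ V⁷`, or `U ∣ 2`; both absurd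
  have hS := splitFiveOctic_eq_pow_add_mul U V
  rw [hV8] at hS
  rcases Int.natAbs_eq (splitFiveOctic U V) with h | h <;> rw [hQ1] at h <;> push_cast at h <;> rw [h] at hS
  · -- `Q₈ = 1`: `U · S₇ = 0`, `S₇ = 0`, so `U ∣ V⁷`
    have hUS : U * (U ^ 7 + U ^ 6 * V + 2 * U ^ 5 * V ^ 2 + 3 * U ^ 4 * V ^ 3 + 5 * U ^ 3 * V ^ 4
        - 3 * U ^ 2 * V ^ 5 + 2 * U * V ^ 6 - V ^ 7) = 0 := by linear_combination -hS
    rcases mul_eq_zero.mp hUS with h' | h'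
    · exact hU h'
    · have hUV7 : U ∣ V ^ 7 := ⟨U ^ 6 + U ^ 5 * V + 2 * U ^ 4 * V ^ 2 + 3 * U ^ 3 * V ^ 3
          + 5 * U ^ 2 * V ^ 4 - 3 * U * V ^ 5 + 2 * V ^ 6, by linear_combination -h'⟩
      have hunit : IsUnit U := (hUV.pow_right (n := 7)).isUnit_of_dvd' (dvd_refl U) hUV7
      rw [Int.isUnit_iff] at hunit
      rcases hunit with rfl | rfl <;> norm_num at h11
  · -- `Q₈ = −1`: `U · (−S₇) = 2`, so `U ∣ 2`, `11 ∣ 2`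
    have hU2' : U ∣ 2 := ⟨-(U ^ 7 + U ^ 6 * V + 2 * U ^ 5 * V ^ 2 + 3 * U ^ 4 * V ^ 3 + 5 * U ^ 3 * V ^ 4
        - 3 * U ^ 2 * V ^ 5 + 2 * U * V ^ 6 - V ^ 7), by linear_combination -hS⟩
    have : (11 : ℤ) ∣ 2 := dvd_trans h11 hU2'
    omega

/-- **Lemma A2 (endgame).** Let `U, V ≠ 0` be coprime integers such that every prime dividing `U V` is `11`
and, if `11 ∣ U V`, every prime dividing `Q₈(U,V)` is `5` or `11`.  Then `U V = ±1`.
[this file; MEMO-es §68.3] -/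
theorem mul_eq_one_or_eq_neg_one_of_splitFive_primes {U V : ℤ} (hUV : IsCoprime U V) (hU : U ≠ 0)
    (hV : V ≠ 0) (hp : ∀ p : ℕ, p.Prime → (p : ℤ) ∣ U * V → p = 11)
    (hQ : (11 : ℤ) ∣ U * V → ∀ p : ℕ, p.Prime → (p : ℤ) ∣ splitFiveOctic U V → p = 5 ∨ p = 11) :
    U * V = 1 ∨ U * V = -1 := by
  by_contra hne
  have habs : (U * V).natAbs ≠ 1 := by
    intro h
    rcases Int.natAbs_eq (U * V) with h' | h' <;> rw [h] at h' <;> push_cast at h'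
    · exact hne (Or.inl h')
    · exact hne (Or.inr h')
  obtain ⟨p, hpp, hpUV⟩ := Nat.exists_prime_and_dvd habs
  have hpZ : (p : ℤ) ∣ U * V := Int.dvd_natAbs.mp (Int.natCast_dvd_natCast.mpr hpUV)
  have hor := (Nat.prime_iff_prime_int.mp hpp).dvd_or_dvd hpZ
  have hp11 : p = 11 := hp p hpp hpZ
  subst hp11
  have hQ' := hQ hpZ
  rcases hor with h11U | h11V
  · exact false_of_eleven_dvd hUV hU hp hQ' (by exact_mod_cast h11U)
  · -- symmetric case via `(U, V) ↦ (V, −U)`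
    refine false_of_eleven_dvd (U := V) (V := -U) hUV.symm.neg_right hV ?_ ?_ (by exact_mod_cast h11V)
    · intro p' hp' hd
      exact hp p' hp' (by rw [show U * V = -(V * -U) by ring]; exact hd.neg_right)
    · intro p' hp' hd
      rw [splitFiveOctic_swap_neg] at hd
      exact hQ' p' hp' hd

end Summit.BirchSwinnertonDyer.BirchSwinnertonDyer.Theorems.ManinLocalTwoThree.ShimuraFive
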